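import Summits.QuantumFields.BalabanUV.Beta.GAN24.AliasObjects
import Summits.QuantumFields.BalabanUV.Beta.GAN24.FibreBlockBounds

/-!
# `BalabanUV.Beta.GAN24.FieldBlockResponse` — binder row G-an2-4 / (CONV-C), road P1-fibre, typer row **P1-Y09a** (node N11a of
# `HOME/GAN24/Formal/DAG.md` v2.2, PARAMETER FORM): the PER-ALIAS FIELD RESPONSE BOUND `‖Â(m)‖ ≤ α(m; Bφ, Bc)` on the regular real zone

NOT IN PRINT; OUR PROOF ATTEMPT.  HONEST FRAMING (cell contract, verbatim): «discharging `BetaPertH` makes Bałaban's UV stability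
UNCONDITIONAL — a real constructive-QFT result; it is NOT the continuum limit and NOT the Clay problem.»  HONEST DEPENDENCY (verbatim):
«continuum YM on T⁴ ⇐ BetaPertH ∧ nine spine estimates (0/9 proved); BetaPertH ⇐ (D1) ∧ (D4) ∧ CAP+tail; G-an2-4 gates asym, D1 and
NE2/3/4.»  [folklore] finite-dimensional norm bookkeeping over `ℂ` (triangle inequality, the landed A3 block bounds BY NAME); no cited fact,
no wall binder, no `def … : Prop`, no unit sequence touched (ref2 c2/c3).  NOT summit progress; discharges nothing of the K-slot
`GAN24.CombesThomas.ConvCK 3 Lc` by itself — it is the hypothesis `hA` of typer row P1-Y09d (`ClosedFormBoundOfParts`) in explicit form.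

## Setting (binding currency = `GAN24/AliasObjects`, typer row P1-T00, p201364; NOTHING is re-defined here)
Block side `N`, coarse momentum `p : Fin D → ℂ` on the REAL ZONE (`∀ μ, conj (p μ) = p μ`, e.g. `p = B4Strip.ofRealVec q`), alias class
`m : TorusSite D N` with fine momentum `kAl N p m`, symbols `dAl/dbAl/LAl N p m = dhat/dflat/lapSym (kAl N p m)`, weights `sAl, SAl, sbAl, chiAl`,
sources `fhat : TorusSite D N → Fin D → ℂ` (EL rows), `chat : Fin D → ℂ` (Q rows), the capacitance feedback `(phiSol, cSol)` and the closed-form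
amplitudes `gAl` (EL feed `f̂(m) + χ̂(m)·s♭(m) ⊙ φ`), `Ahat = FibreBlockSolve.Asol (∂_m) (∂♭_m) (g_m) L_m (χ̂(m)·c)`, `muhat`.  PARAMETER FORM (typer v2.2):
the capacitance feedback enters through the HYPOTHESES `hφ : ∀ κ, ‖phiSol … κ‖ ≤ Bφ`, `hc : ‖cSol …‖ ≤ Bc` (rows Y08f/Y08s/N13 instantiate them);
no invertibility of `cap N p` is used except where said (`§4`, through T00's `arrowSolves_closed`).

## What is proved
* §1 real zone: `conj (kAl N p m κ) = kAl N p m κ` (`conj_kAl`, = `FibreDFTDictionary.conj_kFine`), membership `m ∈ reg N p ↔ LAl N p m ≠ 0` BY NAME.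
* §2 FEED: `‖gAl … m l‖ ≤ ‖fhat m l‖ + ‖chiAl m‖·‖sbAl m l‖·Bφ` (`norm_gAl_le`) and the `ℓ²` form
  `√(Σ_l ‖gAl … m l‖²) ≤ √D·(Fm + ‖chiAl m‖·Sm·Bφ)` under `∀ l, ‖fhat m l‖ ≤ Fm`, `∀ l, ‖sbAl m l‖ ≤ Sm` (`sqrt_sum_sq_gAl_le`).
* §3 GENERIC ALIAS CLASS `m` with `LAl N p m ≠ 0` (A3 BY NAME from `GAN24/FibreBlockBounds`, leaf-11 p201105):
  `norm_Ahat_le` — `‖Ahat … m κ‖ ≤ √(Σ_l‖g_m l‖²)/(2‖L_m‖) + ‖χ̂_m‖·‖c‖/(‖L_m‖√‖L_m‖)`;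
  **`norm_Ahat_le_param`** — `‖Ahat … m κ‖ ≤ α(m) := √D·(Fm + ‖χ̂_m‖·Sm·Bφ)/(2‖L_m‖) + ‖χ̂_m‖·Bc/(‖L_m‖·√‖L_m‖)` (EXPLICIT; = Y09d's `hA`);
  `sum_sq_Ahat_le` (ℓ²: `Σ_κ‖Â_κ(m)‖² ≤ Σ‖g‖²/(4‖L‖²) + ‖χ̂c‖²/‖L‖³`), `norm_muhat_le(_param)` (`‖μ̂(m)‖ ≤ √(Σ‖g‖²)/(‖L‖√‖L‖)`),
  `norm_dot_dbAl_Ahat` (longitudinal content EXACT: `‖∂♭_m·Â(m)‖ = ‖χ̂_m c‖/‖L_m‖`).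
* §4 THE `m = 0` CLASS WITHOUT THE TRANSVERSE POLE `1/(2L₀)` — two forms:
  (a) CANCELLATION form (p1-row L08a `TransverseProjector`, leaf-13 p200737, BY NAME): if the EL feed of a class is LONGITUDINAL,
      `projT (∂_m) (∂♭_m) L_m (g_m) = 0` (the conclusion of `TransverseProjector.cancellation`), then `Ahat … m κ = (χ̂_m c/L_m²)·∂_{mκ}`
      (`Ahat_of_projT_eq_zero`, = `Asol_of_projT_eq_zero`) and `‖Ahat … m κ‖ ≤ ‖χ̂_m‖·Bc·‖∂_{mκ}‖/‖L_m‖² ≤ ‖χ̂_m‖·Bc/(‖L_m‖√‖L_m‖)` — the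
      transverse term of `α(m)` is ABSENT;
  (b) CONSTRAINT form (the Q rows of the arrow system): for ANY amplitudes `A` with `Σ_m S(m)s_κ(m)·A_{mκ} = ĉ_κ` and a class `m₀` with
      `S(m₀)s_κ(m₀) ≠ 0`: `A_{m₀κ} = (ĉ_κ − Σ_{m≠m₀} S(m)s_κ(m)A_{mκ})/(S(m₀)s_κ(m₀))` (`apply_eq_of_QRows`) and
      `‖A_{m₀κ}‖ ≤ (‖ĉ_κ‖ + Σ_{m≠m₀}‖S(m)s_κ(m)‖·‖A_{mκ}‖)/‖S(m₀)s_κ(m₀)‖` (`norm_apply_le_of_QRows`); for the closed-form amplitudes the Q rows hold by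
      T00's `arrowSolves_closed` (all `L_m ≠ 0`, `IsUnit (cap N p).det`): **`norm_Ahat_zero_le_of_QRows`** — the `m₀` amplitude is controlled by the
      CONSTRAINT source and the OTHER classes' `α(m)`, with NO `1/L_{m₀}` at all (at `m₀ = 0`: `|S(0)s_κ(0)| ≍ N^{D+1}` on the zone — row Y09b).
Unit `b2b-balaban-gan24-formalise-leaf-10` (G-an2-4 formalisation swarm), 2026-08-19.  Value = bookkeeping toward L09 of road P1, NOT summit progress.
-/

noncomputable section

open Complex Finset
open scoped BigOperators ComplexConjugate
open Literature.Probability.LatticeModels (TorusSite)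
open Summit.QuantumFields.BalabanUV.Beta.GAN24.FibreSymbols (dhat dflat lapSym)
open Summit.QuantumFields.BalabanUV.Beta.GAN24.FibreBlockSolve (dot Asol musol)
open Summit.QuantumFields.BalabanUV.Beta.GAN24.TransverseProjector (projT Asol_of_projT_eq_zero)
open Summit.QuantumFields.BalabanUV.Beta.GAN24.FibreBlockBounds (sqrt_sum_sq_le_sqrt_card_mul_norm norm_Asol_symbol_le
  sum_sq_Asol_symbol_le norm_musol_symbol_le norm_dot_Asol_symbol norm_dhat_le_sqrt)
open Summit.QuantumFields.BalabanUV.Beta.GAN24.AliasObjects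

namespace Summit.QuantumFields.BalabanUV.Beta.GAN24.FieldBlockResponse

variable {D : ℕ} {N : ℕ} [NeZero N]

/-! ## §1 Real zone -/

/-- [folklore] On the real zone the fine momenta are self-conjugate: `conj (kAl N p m κ) = kAl N p m κ` (`FibreDFTDictionary.conj_kFine`). -/
theorem conj_kAl {p : Fin D → ℂ} (hp : ∀ μ, conj (p μ) = p μ) (m : TorusSite D N) (κ : Fin D) :
    conj (kAl N p m κ) = kAl N p m κ :=
  FibreDFTDictionary.conj_kFine hp m κ

/-- [folklore] `‖∂_{mκ}‖ ≤ √‖L_m‖` on the real zone (`FibreBlockBounds.norm_dhat_le_sqrt`). -/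
theorem norm_dAl_le_sqrt {p : Fin D → ℂ} (hp : ∀ μ, conj (p μ) = p μ) (m : TorusSite D N) (κ : Fin D) :
    ‖dAl N p m κ‖ ≤ Real.sqrt ‖LAl N p m‖ :=
  norm_dhat_le_sqrt (kAl N p m) (conj_kAl hp m) κ

/-! ## §2 The EL feed `g_m = f̂(m) + χ̂(m)·s♭(m) ⊙ φ` -/

/-- [folklore] Unfolding of the feed. -/
theorem gAl_apply (p : Fin D → ℂ) (fhat : TorusSite D N → Fin D → ℂ) (chat : Fin D → ℂ) (m : TorusSite D N) (l : Fin D) :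
    gAl N p fhat chat m l = fhat m l + chiAl N p m * sbAl N p m l * phiSol N p fhat chat l := rfl

/-- [folklore] ENTRYWISE FEED BOUND: `‖g_m l‖ ≤ ‖f̂(m) l‖ + ‖χ̂(m)‖·‖s♭_l(m)‖·Bφ`. -/
theorem norm_gAl_le (p : Fin D → ℂ) (fhat : TorusSite D N → Fin D → ℂ) (chat : Fin D → ℂ) (m : TorusSite D N) (l : Fin D)
    {Bφ : ℝ} (hφ : ∀ κ, ‖phiSol N p fhat chat κ‖ ≤ Bφ) :
    ‖gAl N p fhat chat m l‖ ≤ ‖fhat m l‖ + ‖chiAl N p m‖ * ‖sbAl N p m l‖ * Bφ := by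
  rw [gAl_apply]
  refine (norm_add_le _ _).trans (add_le_add le_rfl ?_)
  rw [norm_mul, norm_mul]
  exact mul_le_mul_of_nonneg_left (hφ l) (by positivity)

/-- [folklore] SUP FEED BOUND: under `‖f̂(m) l‖ ≤ Fm`, `‖s♭_l(m)‖ ≤ Sm` for all `l`: `‖g_m l‖ ≤ Fm + ‖χ̂(m)‖·Sm·Bφ`. -/
theorem norm_gAl_le_param (p : Fin D → ℂ) (fhat : TorusSite D N → Fin D → ℂ) (chat : Fin D → ℂ) (m : TorusSite D N) (l : Fin D)
    {Fm Sm Bφ : ℝ} (hf : ∀ l, ‖fhat m l‖ ≤ Fm) (hs : ∀ l, ‖sbAl N p m l‖ ≤ Sm) (hφ : ∀ κ, ‖phiSol N p fhat chat κ‖ ≤ Bφ) :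
    ‖gAl N p fhat chat m l‖ ≤ Fm + ‖chiAl N p m‖ * Sm * Bφ := by
  have hBφ : 0 ≤ Bφ := (norm_nonneg _).trans (hφ l)
  refine (norm_gAl_le p fhat chat m l hφ).trans (add_le_add (hf l) ?_)
  exact mul_le_mul_of_nonneg_right (mul_le_mul_of_nonneg_left (hs l) (norm_nonneg _)) hBφ

/-- [folklore] `ℓ²` FEED BOUND: `√(Σ_l ‖g_m l‖²) ≤ √D·(Fm + ‖χ̂(m)‖·Sm·Bφ)`. -/
theorem sqrt_sum_sq_gAl_le (p : Fin D → ℂ) (fhat : TorusSite D N → Fin D → ℂ) (chat : Fin D → ℂ) (m : TorusSite D N)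
    {Fm Sm Bφ : ℝ} (hf : ∀ l, ‖fhat m l‖ ≤ Fm) (hs : ∀ l, ‖sbAl N p m l‖ ≤ Sm) (hφ : ∀ κ, ‖phiSol N p fhat chat κ‖ ≤ Bφ) :
    Real.sqrt (∑ l, ‖gAl N p fhat chat m l‖ ^ 2) ≤ Real.sqrt D * (Fm + ‖chiAl N p m‖ * Sm * Bφ) := by
  set B := Fm + ‖chiAl N p m‖ * Sm * Bφ with hB
  have hpt : ∀ l, ‖gAl N p fhat chat m l‖ ≤ B := fun l => norm_gAl_le_param p fhat chat m l hf hs hφ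
  have hsum : ∑ l, ‖gAl N p fhat chat m l‖ ^ 2 ≤ (D : ℝ) * B ^ 2 := by
    calc ∑ l, ‖gAl N p fhat chat m l‖ ^ 2 ≤ ∑ _l : Fin D, B ^ 2 :=
          Finset.sum_le_sum fun l _ => pow_le_pow_left₀ (norm_nonneg _) (hpt l) 2
      _ = (D : ℝ) * B ^ 2 := by rw [Finset.sum_const, Finset.card_univ, Fintype.card_fin, nsmul_eq_mul]
  calc Real.sqrt (∑ l, ‖gAl N p fhat chat m l‖ ^ 2) ≤ Real.sqrt ((D : ℝ) * B ^ 2) := Real.sqrt_le_sqrt hsum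
    _ = Real.sqrt D * |B| := by rw [Real.sqrt_mul (Nat.cast_nonneg D), Real.sqrt_sq_eq_abs]
    _ ≤ Real.sqrt D * B := by
        rcases Nat.eq_zero_or_pos D with hD | hD
        · subst hD; simp
        · have hB0 : 0 ≤ B := (norm_nonneg _).trans (hpt ⟨0, hD⟩)
          rw [abs_of_nonneg hB0]

/-! ## §3 Generic alias class: the A3 block bounds BY NAME -/

/-- [folklore] Unfolding of the closed-form amplitude: `Â(m) = Asol (∂_m) (∂♭_m) (g_m) L_m (χ̂(m)·c)`. -/
theorem Ahat_eq_Asol (p : Fin D → ℂ) (fhat : TorusSite D N → Fin D → ℂ) (chat : Fin D → ℂ) (m : TorusSite D N) :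
    Ahat N p fhat chat m
      = Asol (dhat (kAl N p m)) (dflat (kAl N p m)) (gAl N p fhat chat m) (lapSym (kAl N p m)) (chiAl N p m * cSol N p fhat chat) := rfl

/-- [folklore] Unfolding of the closed-form gauge multiplier: `μ̂(m) = musol (∂♭_m) (g_m) L_m`. -/
theorem muhat_eq_musol (p : Fin D → ℂ) (fhat : TorusSite D N → Fin D → ℂ) (chat : Fin D → ℂ) (m : TorusSite D N) :
    muhat N p fhat chat m = musol (dflat (kAl N p m)) (gAl N p fhat chat m) (lapSym (kAl N p m)) := rfl

/-- [folklore] **GENERIC RESPONSE BOUND** (real zone, `L_m ≠ 0`; `FibreBlockBounds.norm_Asol_symbol_le` BY NAME):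
`‖Â_κ(m)‖ ≤ √(Σ_l‖g_m l‖²)/(2‖L_m‖) + ‖χ̂(m)·c‖/(‖L_m‖·√‖L_m‖)` — transverse `|∂̂|⁻²` part plus gauge-column `|∂̂|⁻³` part. -/
theorem norm_Ahat_le {p : Fin D → ℂ} (hp : ∀ μ, conj (p μ) = p μ) {m : TorusSite D N} (hL0 : LAl N p m ≠ 0)
    (fhat : TorusSite D N → Fin D → ℂ) (chat : Fin D → ℂ) (κ : Fin D) :
    ‖Ahat N p fhat chat m κ‖
      ≤ Real.sqrt (∑ l, ‖gAl N p fhat chat m l‖ ^ 2) / (2 * ‖LAl N p m‖)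
        + ‖chiAl N p m * cSol N p fhat chat‖ / (‖LAl N p m‖ * Real.sqrt ‖LAl N p m‖) :=
  norm_Asol_symbol_le (kAl N p m) (conj_kAl hp m) hL0 _ _ κ

/-- [folklore] **GENERIC RESPONSE BOUND, PARAMETER FORM** (= hypothesis `hA` of typer row P1-Y09d): with `‖f̂(m) l‖ ≤ Fm`, `‖s♭_l(m)‖ ≤ Sm`,
`‖φ_κ‖ ≤ Bφ`, `‖c‖ ≤ Bc`:
`‖Â_κ(m)‖ ≤ α(m) := √D·(Fm + ‖χ̂(m)‖·Sm·Bφ)/(2‖L_m‖) + ‖χ̂(m)‖·Bc/(‖L_m‖·√‖L_m‖)`. -/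
theorem norm_Ahat_le_param {p : Fin D → ℂ} (hp : ∀ μ, conj (p μ) = p μ) {m : TorusSite D N} (hL0 : LAl N p m ≠ 0)
    (fhat : TorusSite D N → Fin D → ℂ) (chat : Fin D → ℂ) {Fm Sm Bφ Bc : ℝ}
    (hf : ∀ l, ‖fhat m l‖ ≤ Fm) (hs : ∀ l, ‖sbAl N p m l‖ ≤ Sm) (hφ : ∀ κ, ‖phiSol N p fhat chat κ‖ ≤ Bφ)
    (hc : ‖cSol N p fhat chat‖ ≤ Bc) (κ : Fin D) :
    ‖Ahat N p fhat chat m κ‖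
      ≤ Real.sqrt D * (Fm + ‖chiAl N p m‖ * Sm * Bφ) / (2 * ‖LAl N p m‖)
        + ‖chiAl N p m‖ * Bc / (‖LAl N p m‖ * Real.sqrt ‖LAl N p m‖) := by
  have hL : 0 < ‖LAl N p m‖ := norm_pos_iff.2 hL0
  refine (norm_Ahat_le hp hL0 fhat chat κ).trans (add_le_add ?_ ?_)
  · exact div_le_div_of_nonneg_right (sqrt_sum_sq_gAl_le p fhat chat m hf hs hφ) (by positivity)
  · refine div_le_div_of_nonneg_right ?_ (by positivity)
    rw [norm_mul]
    exact mul_le_mul_of_nonneg_left hc (norm_nonneg _)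

/-- [folklore] **`ℓ²` RESPONSE BOUND** (orthogonality of the transverse and gauge parts, `FibreBlockBounds.sum_sq_Asol_symbol_le`):
`Σ_κ ‖Â_κ(m)‖² ≤ Σ_l‖g_m l‖²/(4‖L_m‖²) + ‖χ̂(m)·c‖²/‖L_m‖³`. -/
theorem sum_sq_Ahat_le {p : Fin D → ℂ} (hp : ∀ μ, conj (p μ) = p μ) {m : TorusSite D N} (hL0 : LAl N p m ≠ 0)
    (fhat : TorusSite D N → Fin D → ℂ) (chat : Fin D → ℂ) :
    ∑ κ, ‖Ahat N p fhat chat m κ‖ ^ 2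
      ≤ (∑ l, ‖gAl N p fhat chat m l‖ ^ 2) / (4 * ‖LAl N p m‖ ^ 2) + ‖chiAl N p m * cSol N p fhat chat‖ ^ 2 / ‖LAl N p m‖ ^ 3 :=
  sum_sq_Asol_symbol_le (kAl N p m) (conj_kAl hp m) hL0 _ _

/-- [folklore] **GAUGE MULTIPLIER BOUND**: `‖μ̂(m)‖ ≤ √(Σ_l‖g_m l‖²)/(‖L_m‖·√‖L_m‖)` (`FibreBlockBounds.norm_musol_symbol_le`). -/
theorem norm_muhat_le {p : Fin D → ℂ} (hp : ∀ μ, conj (p μ) = p μ) {m : TorusSite D N} (hL0 : LAl N p m ≠ 0)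
    (fhat : TorusSite D N → Fin D → ℂ) (chat : Fin D → ℂ) :
    ‖muhat N p fhat chat m‖ ≤ Real.sqrt (∑ l, ‖gAl N p fhat chat m l‖ ^ 2) / (‖LAl N p m‖ * Real.sqrt ‖LAl N p m‖) :=
  norm_musol_symbol_le (kAl N p m) (conj_kAl hp m) hL0 _

/-- [folklore] Gauge multiplier, parameter form: `‖μ̂(m)‖ ≤ √D·(Fm + ‖χ̂(m)‖·Sm·Bφ)/(‖L_m‖·√‖L_m‖)`. -/
theorem norm_muhat_le_param {p : Fin D → ℂ} (hp : ∀ μ, conj (p μ) = p μ) {m : TorusSite D N} (hL0 : LAl N p m ≠ 0)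
    (fhat : TorusSite D N → Fin D → ℂ) (chat : Fin D → ℂ) {Fm Sm Bφ : ℝ}
    (hf : ∀ l, ‖fhat m l‖ ≤ Fm) (hs : ∀ l, ‖sbAl N p m l‖ ≤ Sm) (hφ : ∀ κ, ‖phiSol N p fhat chat κ‖ ≤ Bφ) :
    ‖muhat N p fhat chat m‖ ≤ Real.sqrt D * (Fm + ‖chiAl N p m‖ * Sm * Bφ) / (‖LAl N p m‖ * Real.sqrt ‖LAl N p m‖) := by
  have hL : 0 < ‖LAl N p m‖ := norm_pos_iff.2 hL0
  exact (norm_muhat_le hp hL0 fhat chat).trans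
    (div_le_div_of_nonneg_right (sqrt_sum_sq_gAl_le p fhat chat m hf hs hφ) (by positivity))

/-- [folklore] **LONGITUDINAL CONTENT IS EXACT**: `‖∂♭_m · Â(m)‖ = ‖χ̂(m)·c‖/‖L_m‖` (`FibreBlockBounds.norm_dot_Asol_symbol`; any `L_m ≠ 0`). -/
theorem norm_dot_dbAl_Ahat (p : Fin D → ℂ) {m : TorusSite D N} (hL0 : LAl N p m ≠ 0)
    (fhat : TorusSite D N → Fin D → ℂ) (chat : Fin D → ℂ) :
    ‖dot (dbAl N p m) (Ahat N p fhat chat m)‖ = ‖chiAl N p m * cSol N p fhat chat‖ / ‖LAl N p m‖ :=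
  norm_dot_Asol_symbol (kAl N p m) hL0 _ _

/-- [folklore] On the regular zone: `m ∈ reg N p` supplies `L_m ≠ 0` (`AliasObjects.mem_reg`), so the bounds above hold for every `m ∈ reg N p`. -/
theorem norm_Ahat_le_param_of_mem_reg {p : Fin D → ℂ} (hp : ∀ μ, conj (p μ) = p μ) {m : TorusSite D N} (hm : m ∈ reg N p)
    (fhat : TorusSite D N → Fin D → ℂ) (chat : Fin D → ℂ) {Fm Sm Bφ Bc : ℝ}
    (hf : ∀ l, ‖fhat m l‖ ≤ Fm) (hs : ∀ l, ‖sbAl N p m l‖ ≤ Sm) (hφ : ∀ κ, ‖phiSol N p fhat chat κ‖ ≤ Bφ)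
    (hc : ‖cSol N p fhat chat‖ ≤ Bc) (κ : Fin D) :
    ‖Ahat N p fhat chat m κ‖
      ≤ Real.sqrt D * (Fm + ‖chiAl N p m‖ * Sm * Bφ) / (2 * ‖LAl N p m‖)
        + ‖chiAl N p m‖ * Bc / (‖LAl N p m‖ * Real.sqrt ‖LAl N p m‖) :=
  norm_Ahat_le_param hp ((mem_reg N p m).1 hm) fhat chat hf hs hφ hc κ

/-! ## §4 The `m = 0` class without the transverse pole -/

/-- [folklore] **(a) CANCELLATION FORM** (p1-row L08a `TransverseProjector` BY NAME): if the EL feed of the class `m` is LONGITUDINAL —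
`projT (∂_m) (∂♭_m) L_m g_m = 0`, the conclusion of `TransverseProjector.cancellation` for the `m = 0` sector — then the amplitude is PURE GAUGE:
`Â_κ(m) = (χ̂(m)·c/L_m²)·∂_{mκ}` (no `1/(2L_m)` transverse term). -/
theorem Ahat_of_projT_eq_zero (p : Fin D → ℂ) (fhat : TorusSite D N → Fin D → ℂ) (chat : Fin D → ℂ) (m : TorusSite D N)
    (hT : projT (dAl N p m) (dbAl N p m) (LAl N p m) (gAl N p fhat chat m) = 0) (κ : Fin D) :
    Ahat N p fhat chat m κ = (chiAl N p m * cSol N p fhat chat / LAl N p m ^ 2) * dAl N p m κ :=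
  Asol_of_projT_eq_zero _ _ _ _ _ hT κ

/-- [folklore] (a) continued: under the longitudinal-feed hypothesis, `‖Â_κ(m)‖ ≤ ‖χ̂(m)‖·Bc·‖∂_{mκ}‖/‖L_m‖²`. -/
theorem norm_Ahat_le_of_projT_eq_zero (p : Fin D → ℂ) (fhat : TorusSite D N → Fin D → ℂ) (chat : Fin D → ℂ) (m : TorusSite D N)
    (hT : projT (dAl N p m) (dbAl N p m) (LAl N p m) (gAl N p fhat chat m) = 0) {Bc : ℝ} (hc : ‖cSol N p fhat chat‖ ≤ Bc) (κ : Fin D) :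
    ‖Ahat N p fhat chat m κ‖ ≤ ‖chiAl N p m‖ * Bc * ‖dAl N p m κ‖ / ‖LAl N p m‖ ^ 2 := by
  rw [Ahat_of_projT_eq_zero p fhat chat m hT κ, norm_mul, norm_div, norm_mul, norm_pow]
  rw [div_mul_eq_mul_div]
  refine div_le_div_of_nonneg_right ?_ (by positivity)
  exact mul_le_mul_of_nonneg_right (mul_le_mul_of_nonneg_left hc (norm_nonneg _)) (norm_nonneg _)

/-- [folklore] (a) in the `|∂̂|⁻³` currency of A3: under the longitudinal-feed hypothesis and on the real zone,
`‖Â_κ(m)‖ ≤ ‖χ̂(m)‖·Bc/(‖L_m‖·√‖L_m‖)` — exactly the gauge half of `α(m)`, the transverse half is ABSENT. -/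
theorem norm_Ahat_le_of_projT_eq_zero' {p : Fin D → ℂ} (hp : ∀ μ, conj (p μ) = p μ) (fhat : TorusSite D N → Fin D → ℂ) (chat : Fin D → ℂ)
    {m : TorusSite D N} (hL0 : LAl N p m ≠ 0)
    (hT : projT (dAl N p m) (dbAl N p m) (LAl N p m) (gAl N p fhat chat m) = 0) {Bc : ℝ} (hc : ‖cSol N p fhat chat‖ ≤ Bc) (κ : Fin D) :
    ‖Ahat N p fhat chat m κ‖ ≤ ‖chiAl N p m‖ * Bc / (‖LAl N p m‖ * Real.sqrt ‖LAl N p m‖) := by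
  have hL : 0 < ‖LAl N p m‖ := norm_pos_iff.2 hL0
  have hs : 0 < Real.sqrt ‖LAl N p m‖ := Real.sqrt_pos.2 hL
  have hBc : 0 ≤ Bc := (norm_nonneg _).trans hc
  refine (norm_Ahat_le_of_projT_eq_zero p fhat chat m hT hc κ).trans ?_
  have hd := norm_dAl_le_sqrt hp m κ
  -- ‖χ‖Bc‖∂_κ‖/‖L‖² ≤ ‖χ‖Bc√‖L‖/‖L‖² = ‖χ‖Bc/(‖L‖√‖L‖)
  have hsq : Real.sqrt ‖LAl N p m‖ * Real.sqrt ‖LAl N p m‖ = ‖LAl N p m‖ := Real.mul_self_sqrt hL.le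
  calc ‖chiAl N p m‖ * Bc * ‖dAl N p m κ‖ / ‖LAl N p m‖ ^ 2
      ≤ ‖chiAl N p m‖ * Bc * Real.sqrt ‖LAl N p m‖ / ‖LAl N p m‖ ^ 2 := by gcongr
    _ = ‖chiAl N p m‖ * Bc / (‖LAl N p m‖ * Real.sqrt ‖LAl N p m‖) := by
        rw [div_eq_div_iff (by positivity) (by positivity)]
        calc ‖chiAl N p m‖ * Bc * Real.sqrt ‖LAl N p m‖ * (‖LAl N p m‖ * Real.sqrt ‖LAl N p m‖)
            = ‖chiAl N p m‖ * Bc * ‖LAl N p m‖ * (Real.sqrt ‖LAl N p m‖ * Real.sqrt ‖LAl N p m‖) := by ring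
          _ = ‖chiAl N p m‖ * Bc * ‖LAl N p m‖ ^ 2 := by rw [hsq]; ring

/-- [folklore] **(b) CONSTRAINT FORM, algebra**: if amplitudes `A` satisfy the Q rows `Σ_m S(m)s_κ(m)·A_{mκ} = ĉ_κ` and the class `m₀` has
`S(m₀)s_κ(m₀) ≠ 0`, then `A_{m₀κ} = (ĉ_κ − Σ_{m ≠ m₀} S(m)s_κ(m)A_{mκ}) / (S(m₀)s_κ(m₀))`. -/
theorem apply_eq_of_QRows (p : Fin D → ℂ) (A : TorusSite D N → Fin D → ℂ) (chat : Fin D → ℂ) (κ : Fin D)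
    (hQ : ∑ m, SAl N p m * sAl N p m κ * A m κ = chat κ) {m₀ : TorusSite D N} (h0 : SAl N p m₀ * sAl N p m₀ κ ≠ 0) :
    A m₀ κ = (chat κ - ∑ m ∈ Finset.univ.erase m₀, SAl N p m * sAl N p m κ * A m κ) / (SAl N p m₀ * sAl N p m₀ κ) := by
  rw [← Finset.add_sum_erase _ _ (Finset.mem_univ m₀)] at hQ
  rw [eq_div_iff h0]
  linear_combination hQ

/-- [folklore] **(b) CONSTRAINT FORM, bound**: `‖A_{m₀κ}‖ ≤ (‖ĉ_κ‖ + Σ_{m ≠ m₀} ‖S(m)s_κ(m)‖·‖A_{mκ}‖)/‖S(m₀)s_κ(m₀)‖` — NO `1/L_{m₀}`. -/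
theorem norm_apply_le_of_QRows (p : Fin D → ℂ) (A : TorusSite D N → Fin D → ℂ) (chat : Fin D → ℂ) (κ : Fin D)
    (hQ : ∑ m, SAl N p m * sAl N p m κ * A m κ = chat κ) {m₀ : TorusSite D N} (h0 : SAl N p m₀ * sAl N p m₀ κ ≠ 0) :
    ‖A m₀ κ‖ ≤ (‖chat κ‖ + ∑ m ∈ Finset.univ.erase m₀, ‖SAl N p m * sAl N p m κ‖ * ‖A m κ‖) / ‖SAl N p m₀ * sAl N p m₀ κ‖ := by
  rw [apply_eq_of_QRows p A chat κ hQ h0, norm_div]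
  refine div_le_div_of_nonneg_right ?_ (norm_nonneg _)
  refine (norm_sub_le _ _).trans (add_le_add le_rfl ?_)
  refine (norm_sum_le _ _).trans (le_of_eq ?_)
  exact Finset.sum_congr rfl fun m _ => by rw [norm_mul]

/-- [folklore] **(b) FOR THE CLOSED-FORM AMPLITUDES**: on the regular real zone with `cap N p` invertible, the Q rows hold for `Â`
(T00's `arrowSolves_closed`), so for every class `m₀` with `S(m₀)s_κ(m₀) ≠ 0` — in particular `m₀ = 0`, where `|S(0)s_κ(0)| ≍ N^{D+1}` on the zone —
`‖Â_κ(m₀)‖ ≤ (‖ĉ_κ‖ + Σ_{m ≠ m₀} ‖S(m)s_κ(m)‖·‖Â_κ(m)‖)/‖S(m₀)s_κ(m₀)‖`: the `m₀` amplitude is controlled by the CONSTRAINT source and the other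
classes' responses, with no transverse pole `1/(2L_{m₀})`. -/
theorem norm_Ahat_le_of_QRows (p : Fin D → ℂ) (h : ∀ m, LAl N p m ≠ 0) (hdet : IsUnit (cap N p).det)
    (fhat : TorusSite D N → Fin D → ℂ) (chat : Fin D → ℂ) (κ : Fin D) {m₀ : TorusSite D N} (h0 : SAl N p m₀ * sAl N p m₀ κ ≠ 0) :
    ‖Ahat N p fhat chat m₀ κ‖
      ≤ (‖chat κ‖ + ∑ m ∈ Finset.univ.erase m₀, ‖SAl N p m * sAl N p m κ‖ * ‖Ahat N p fhat chat m κ‖) / ‖SAl N p m₀ * sAl N p m₀ κ‖ := by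
  have hQ := (arrowSolves_closed N p h hdet fhat chat).2.2.2 κ
  exact norm_apply_le_of_QRows p (Ahat N p fhat chat) chat κ hQ h0

/-- [folklore] (b) with the generic bound inserted for the other classes: if `‖Â_κ(m)‖ ≤ α m` for all `m ≠ m₀` then
`‖Â_κ(m₀)‖ ≤ (‖ĉ_κ‖ + Σ_{m ≠ m₀} ‖S(m)s_κ(m)‖·α m)/‖S(m₀)s_κ(m₀)‖`. -/
theorem norm_Ahat_le_of_QRows_of_bound (p : Fin D → ℂ) (h : ∀ m, LAl N p m ≠ 0) (hdet : IsUnit (cap N p).det)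
    (fhat : TorusSite D N → Fin D → ℂ) (chat : Fin D → ℂ) (κ : Fin D) {m₀ : TorusSite D N} (h0 : SAl N p m₀ * sAl N p m₀ κ ≠ 0)
    {α : TorusSite D N → ℝ} (hα : ∀ m, m ≠ m₀ → ‖Ahat N p fhat chat m κ‖ ≤ α m) :
    ‖Ahat N p fhat chat m₀ κ‖ ≤ (‖chat κ‖ + ∑ m ∈ Finset.univ.erase m₀, ‖SAl N p m * sAl N p m κ‖ * α m) / ‖SAl N p m₀ * sAl N p m₀ κ‖ := by
  refine (norm_Ahat_le_of_QRows p h hdet fhat chat κ h0).trans (div_le_div_of_nonneg_right (add_le_add le_rfl ?_) (norm_nonneg _))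
  exact Finset.sum_le_sum fun m hm => mul_le_mul_of_nonneg_left (hα m (Finset.ne_of_mem_erase hm)) (norm_nonneg _)

end Summit.QuantumFields.BalabanUV.Beta.GAN24.FieldBlockResponse

end
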